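import Mathlib
import Literature.Computability.MetaComplexity.ChenJinWilliams2020.ExplicitObstructions
import Literature.Computability.Complexity.CodeFP
import Literature.Computability.Complexity.CodeFPArith
import Literature.Computability.Complexity.Williams2014StageAFP
import HarnessLib

/-!
# Chen–Jin–Williams 2020, Proposition 1.17 — the printed obstruction `S` runs in polynomial time
# (discharging `UnitObstructionPolyTime`; census row R59, known side, now PROVED outright)

Citation header. L. Chen, C. Jin, R. R. Williams, *Sharp threshold results for computational
complexity*, STOC 2020, 1335–1348, doi:10.1145/3357713.3384283 [bib: `ChenJinWilliams2020`],
Proposition 1.17 ("Reminder", p. 28 of the held text layer `paper:doi-10-1145-3357713-3384283`):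
*"There are explicit obstructions against B₂-formulas of size o(n), and branching programs of size
o(n)."* Proof (p. 28): *"Note that an o(n)-size B₂-formula (or o(n)-size branching program) does
not depend on all of its inputs. In such a case, our obstruction can simply be the set
S = {(0ⁿ, 0)} ∪ {(0^{i−1}10^{n−i}, 1) | i ∈ [n]}."*

`ExplicitObstructions.lean` (`ChenJinWilliams2020`, p181656) proves the combinatorial half of this
proposition — the list `unitObstruction n = S` has pairwise distinct inputs and refutes every
`n`-input function computed by a `B₂`-formula of leaf size `< n` or a branching program with `< n`
inner nodes — and states Proposition 1.17 from the RESIDUAL HYPOTHESIS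
`UnitObstructionPolyTime : PolyTimeComputable unaryEncodeNat obstructionEncode unitObstruction`
("a routine TM2 program, not written here"). This file WRITES that program, in the tree's typed
polynomial-time calculus `CodeFP` (`CodeFP.lean`, `CodeFPArith.lean`: maps between encoded types
computed on codes by an `FP` string function, closed under composition, pairing, bounded `map`,
unary/binary numerals and string take/drop/append), so that Proposition 1.17 holds outright:

* `unitObstruction_codeFP : CodeFP unE obstructionEncode unitObstruction` — the program: on `1ⁿ`,
  emit `0ⁿ ++ [0]`, then for `i ∈ [0, n)` (`CodeFP.urange`) the string `0ⁱ 1 0^{n−i−1} ++ [1]`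
  (`MachineA.falses_code` for the zero blocks, `CodeFP.unOfNatMin` to turn the binary loop index into a
  unary count `≤ n`, `CodeFP.strDrop` / `strAppend`, `CodeFP.map` for the loop, `CodeFP.rawCons`);
* `unitObstructionPolyTime : UnitObstructionPolyTime` (`CodeFP.polyTimeComputable`);
* `prop1_17_holds : prop1_17` and `isExplicitObstruction_unitObstruction'` — **Proposition 1.17,
  proved**: for every `s` with `s n < n` eventually (in particular every `s = o(n)`), `S` is an
  explicit obstruction against `B₂`-formulas of size `s` and against branching programs of size `s`.

No new cited fact; nothing is asserted. The output code `obstructionEncode` (each pair `(x, y)` as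
the string `x ++ [y]`, the list as nested pairs `encList`) is literally `CodeFP.rawE` of the item
code `x ++ [y]` (`obstructionEncode_eq_rawE`, `rfl`).

References: [ChenJinWilliams2020] Prop. 1.17 and its proof, p. 28; S. Arora, B. Barak,
*Computational Complexity: A Modern Approach*, CUP 2009, §1.2–1.3 (closure properties of
polynomial time used by `CodeFP`) [bib: `AroraBarak2009`].
-/

namespace Literature.Computability.MetaComplexity.ChenJinWilliams2020

open Literature.Computability.Complexity Literature.Computability.Complexity.CodeFP Filter

/-! ### The item code and the target strings -/

/-- The code of one obstruction pair: `(x, y) ↦ x ++ [y]`. [cite: ChenJinWilliams2020, Def. 1.12 (output list)] -/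
def pairCode (p : List Bool × Bool) : List Bool := p.1 ++ [p.2]

/-- `obstructionEncode` is the raw list code over `pairCode`. [folklore] -/
theorem obstructionEncode_eq_rawE : obstructionEncode = rawE pairCode := rfl

/-- The head string of `S`: `0ⁿ ++ [0]`. [cite: ChenJinWilliams2020, Prop. 1.17 (proof)] -/
def headStr (n : ℕ) : List Bool := List.replicate n false ++ [false]

/-- The `i`-th loop string of `S` as the program computes it from `(1ⁿ, bin i)`:
`0^{min i n} ++ ([1] ++ (0ⁿ ⇂ (min i n + 1))) ++ [1]` — for `i < n` this is `0ⁱ 1 0^{n−i−1} ++ [1]`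
(`itemStr_eq`). [cite: ChenJinWilliams2020, Prop. 1.17 (proof)] -/
def itemStr (n i : ℕ) : List Bool :=
  List.replicate (min i n) false ++ (([true] ++ (List.replicate n false).drop (min i n + 1)) ++ [true])

/-- The unit vector `eᵢ ∈ {0,1}ⁿ` as a list: `0ⁱ 1 0^{n−i−1}`. [folklore] -/
theorem ofFn_decide_eq : ∀ (n : ℕ) (i : Fin n),
    List.ofFn (fun j : Fin n => decide (j = i)) =
      List.replicate i false ++ (true :: List.replicate (n - (i + 1)) false)
  | 0, i => i.elim0
  | n + 1, i => by
    induction i using Fin.cases with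
    | zero =>
      rw [List.ofFn_succ]
      simp [Fin.succ_ne_zero, List.ofFn_const]
    | succ i =>
      rw [List.ofFn_succ]
      have ih := ofFn_decide_eq n i
      have h0 : decide ((0 : Fin (n + 1)) = i.succ) = false := by simp [(Fin.succ_ne_zero i).symm]
      have ht : (fun j : Fin n => decide (j.succ = i.succ)) = fun j => decide (j = i) := by
        funext j; simp [Fin.succ_inj]
      rw [h0, ht, ih]
      simp [List.replicate_succ]

/-- For a loop index `i < n` the program's string is the printed pair `(eᵢ, 1)` in code.
[cite: ChenJinWilliams2020, Prop. 1.17 (proof)] -/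
theorem itemStr_eq (n : ℕ) (i : Fin n) :
    itemStr n i = pairCode (List.ofFn (fun j : Fin n => decide (j = i)), true) := by
  rw [pairCode, ofFn_decide_eq, itemStr, Nat.min_eq_left (le_of_lt i.2), List.drop_replicate]
  simp [List.append_assoc]

/-- The program's output list is `S` in code, item by item. [cite: ChenJinWilliams2020, Prop. 1.17 (proof)] -/
theorem strs_eq (n : ℕ) :
    headStr n :: (List.range n).map (itemStr n) = (unitObstruction n).map pairCode := by
  rw [unitObstruction, List.map_cons, List.map_map, ← List.map_coe_finRange_eq_range, List.map_map]
  refine congrArg₂ _ rfl (List.map_congr_left fun i _ => ?_)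
  simp only [Function.comp_apply]
  exact itemStr_eq n i

/-! ### The program -/

/-- `(1ⁿ, bin i) ↦ itemStr n i`. [cite: AroraBarak2009, §1.2–1.3 (closure of polynomial time)] -/
theorem itemStr_codeFP : CodeFP (pairE unE natE) strE (fun p => itemStr p.1 p.2) := by
  have hi : CodeFP (pairE unE natE) unE (fun p => min p.2 p.1) := unOfNatMin
  have hA : CodeFP (pairE unE natE) strE (fun p => List.replicate (min p.2 p.1) false) :=
    MachineA.falses_code.comp hi
  have hZ : CodeFP (pairE unE natE) strE (fun p => List.replicate p.1 false) :=
    MachineA.falses_code.comp (fst unE natE)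
  have hB : CodeFP (pairE unE natE) strE
      (fun p => (List.replicate p.1 false).drop (min p.2 p.1 + 1)) :=
    (strDrop.comp ((unSucc.comp hi).pair hZ)).congr fun _ => rfl
  have hT : CodeFP (pairE unE natE) strE (fun _ => [true]) := const _ [true]
  exact (strAppend.comp (hA.pair (strAppend.comp ((strAppend.comp (hT.pair hB)).pair hT)))).congr
    fun _ => rfl

/-- `1ⁿ ↦ [itemStr n 0, …, itemStr n (n-1)]` (a bounded `map` over `urange`).
[cite: AroraBarak2009, §1.2–1.3 (polynomially bounded loops)] -/
theorem items_codeFP : CodeFP unE (rawE strE) (fun n => (List.range n).map (itemStr n)) :=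
  ((map (σ := ℕ) (eσ := unE) (α := ℕ) (eα := natE) (β := List Bool) (eβ := strE)
      itemStr_codeFP).comp ((CodeFP.id unE).pair urange)).congr fun _ => rfl

/-- `1ⁿ ↦ headStr n`. [folklore] -/
theorem headStr_codeFP : CodeFP unE strE headStr :=
  (strAppend.comp (MachineA.falses_code.pair (const unE [false]))).congr fun _ => rfl

/-- **The printed obstruction `S` is computed on codes in polynomial time**: `1ⁿ ↦` the code
`obstructionEncode (unitObstruction n)`. [cite: ChenJinWilliams2020, Prop. 1.17 (proof: "our obstruction can simply be the set S")] -/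
theorem unitObstruction_codeFP : CodeFP unE obstructionEncode unitObstruction := by
  have h : CodeFP unE (rawE strE) (fun n => headStr n :: (List.range n).map (itemStr n)) :=
    (rawCons strE).comp (headStr_codeFP.pair items_codeFP)
  refine h.recodeOut fun n => ?_
  rw [strs_eq, obstructionEncode_eq_rawE]
  simp [rawE, List.map_map, strE]

/-- **The residual hypothesis of `ExplicitObstructions.lean` discharged.**
[cite: ChenJinWilliams2020, Prop. 1.17 (proof)] -/
theorem unitObstructionPolyTime : UnitObstructionPolyTime :=
  unitObstruction_codeFP.polyTimeComputable

/-- **Proposition 1.17 (Chen–Jin–Williams 2020), proved**: for every size bound `s` with `s n < n`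
eventually, `S` is an explicit obstruction against `B₂`-formulas of size `s` and against branching
programs of size `s`. [cite: ChenJinWilliams2020, Prop. 1.17] -/
theorem isExplicitObstruction_unitObstruction' {s : ℕ → ℕ} (hs : ∀ᶠ n in atTop, s n < n) :
    IsExplicitObstruction (b2FormulaFns s) unitObstruction ∧
      IsExplicitObstruction (bpFns s) unitObstruction :=
  isExplicitObstruction_unitObstruction unitObstructionPolyTime hs

/-- **Proposition 1.17, proved** (the typed statement `prop1_17` of `ExplicitObstructions.lean`:
explicit obstructions against `B₂`-formulas and branching programs of every size `s = o(n)`).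
[cite: ChenJinWilliams2020, Prop. 1.17] -/
theorem prop1_17_holds : prop1_17 := prop1_17_of_polyTime unitObstructionPolyTime

/-- In particular (the census's K side of row R59, unconditional): explicit obstructions exist
against `B₂`-formulas with at most `n − 1` leaves and branching programs with at most `n − 1`
inner nodes. [cite: ChenJinWilliams2020, Prop. 1.17] -/
theorem hasExplicitObstruction_pred :
    HasExplicitObstruction (b2FormulaFns fun n => n - 1) ∧ HasExplicitObstruction (bpFns fun n => n - 1) :=
  let h := isExplicitObstruction_unitObstruction' (s := fun n => n - 1)
    ((eventually_ge_atTop 1).mono fun _ hn => Nat.sub_lt hn one_pos)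
  ⟨⟨_, h.1⟩, ⟨_, h.2⟩⟩

end Literature.Computability.MetaComplexity.ChenJinWilliams2020

/-! ## `_holds` aliases (appended 2026-08-28)

The named fact(s) below are already theorems of the tree under another name; the `_holds`
alias records the discharge under the tree's naming convention (D-0026 bookkeeping: proof term =
the existing theorem, no statement or definition edited). -/

/-- `UnitObstructionPolyTime` is a theorem of the tree (`Literature.Computability.MetaComplexity.ChenJinWilliams2020.unitObstructionPolyTime`). [cite: ChenJinWilliams2020, Prop. 1.17 (proof: "can simply be the set S")] -/
theorem _root_.Literature.Computability.MetaComplexity.ChenJinWilliams2020.UnitObstructionPolyTime_holds : _root_.Literature.Computability.MetaComplexity.ChenJinWilliams2020.UnitObstructionPolyTime :=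
  _root_.Literature.Computability.MetaComplexity.ChenJinWilliams2020.unitObstructionPolyTime
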